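import Summits.Ventures.Crystal3D.Theorems.StickyWulffConstantTextureBuildCutFrames
import HarnessLib

/-!
# TB-energy blueprint, the CUT SPECIALS, part 2: their total weight is paid by the cells' charges and slice excess — (L-C) of `stub_LS`
# (lane T, crux `TextureLiminfV5`, stmt-Ventures-23912; TB-D-3-g20 §stub_LS (CUTS))

HONEST FRAMING. Venture `Summits/Ventures/Crystal3D` (cell `crystal3d-full`), route `route-Ventures-StickyWulffConstant`, helper `--supports` the
law-v5 crux `TextureLiminfV5` (stmt-Ventures-23912).  Two small DEFINITIONS (`IsCutSpecial`, `cutSpecialSum`: the cut half of the blueprint's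
`IsSpecial` / `specialSum`) + finite-sum bookkeeping over the labelled cells (standard axioms; no mesh constructed; F-C1 not moved).

WHAT.  `TexInput.cutSpecialSum_le`: for a texture input whose cut levels satisfy the Cavalieri clause `Good.hcut` (…CutInput `Mesh₄.exists_good_cut`),
`cutSpecialSum ≤ chargeSum + 13/25·Σ_k ex k`.  Per cell `k`: a ledger term across the cut plane between a piece below (class `(fk k, a)`) and a piece
above (class `(gk k, b)`) is at most `c_k(a,b)/2 ·` its area (…CutFrames `cut_term_le/'`), same-side terms vanish, and the areas of the
(below-`a`) × (above-`b`) contacts add up inside the cut region of the slab pair (`sum_sum_facetArea_cut_le`); both halves of the ledger give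
`Σ_{(a,b)} c_k(a,b) · area(cut region) ≤ charge_k + 13/25·ex_k`.  The CURTAIN half of `stub_LS` (riser boxes) is the riser package's (B6).
-/

noncomputable section

open scoped BigOperators InnerProductSpace ENNReal
open MeasureTheory Set

namespace Summit.Ventures.Crystal3D.Cruxes.TextureLiminf.TexShadow

open Summit.Ventures.Crystal3D Summit.Ventures.Crystal3D.Theorems

/-- `biUnion`-type bound: a sum over a filter by an existential is at most the sum of the sums over the instances (nonnegative terms). -/
private theorem sum_filter_le_sum_sum_filter {α κ : Type*} [Fintype κ] [DecidableEq α] (S : Finset α) (Q : α → Prop) [DecidablePred Q]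
    (P : κ → α → Prop) [∀ k, DecidablePred (P k)] (hQ : ∀ a, Q a → ∃ k, P k a) (g : α → ℝ) (hg : ∀ a, 0 ≤ g a) :
    ∑ a ∈ S.filter Q, g a ≤ ∑ k, ∑ a ∈ S.filter (P k), g a := by
  classical
  have key : ∀ (s : Finset κ) (A : Finset α), (∀ a ∈ A, ∃ k ∈ s, P k a) → A ⊆ S → ∑ a ∈ A, g a ≤ ∑ k ∈ s, ∑ a ∈ S.filter (P k), g a := by
    intro s
    induction s using Finset.induction_on with
    | empty =>
      intro A hA _
      have : A = ∅ := Finset.eq_empty_of_forall_notMem fun a ha => by obtain ⟨k, hk, -⟩ := hA a ha; simp at hk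
      rw [this]; simp
    | @insert k₀ s hk₀ ih =>
      intro A hA hAS
      rw [Finset.sum_insert hk₀]
      -- split `A` into the part served by `k₀` and the rest
      have hsplit : ∑ a ∈ A, g a = ∑ a ∈ A.filter (P k₀), g a + ∑ a ∈ A.filter (fun a => ¬ P k₀ a), g a :=
        (Finset.sum_filter_add_sum_filter_not A (P k₀) g).symm
      rw [hsplit]
      refine add_le_add ?_ ?_
      · exact Finset.sum_le_sum_of_subset_of_nonneg (fun a ha => by
          obtain ⟨haA, hPa⟩ := Finset.mem_filter.1 ha
          exact Finset.mem_filter.2 ⟨hAS haA, hPa⟩) (fun a _ _ => hg a)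
      · refine ih _ (fun a ha => ?_) (fun a ha => hAS (Finset.mem_filter.1 ha).1)
        obtain ⟨haA, hna⟩ := Finset.mem_filter.1 ha
        obtain ⟨k, hk, hPk⟩ := hA a haA
        rcases Finset.mem_insert.1 hk with rfl | hk'
        · exact absurd hPk hna
        · exact ⟨k, hk', hPk⟩
  exact key Finset.univ (S.filter Q) (fun a ha => by
    obtain ⟨k, hk⟩ := hQ a (Finset.mem_filter.1 ha).2; exact ⟨k, Finset.mem_univ _, hk⟩) (Finset.filter_subset _ _)

/-- `0 ≤ if P then x else 0` for `0 ≤ x`. -/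
private theorem ite_nonneg_of {P : Prop} [Decidable P] {x : ℝ} (h : 0 ≤ x) : 0 ≤ (if P then x else 0) := by
  split_ifs
  · exact h
  · exact le_rfl

namespace TexInput

variable {C R₀ : ℝ} {N : ℕ} {x : Fin N → E3} {rc : RiseredCover C R₀ N x} {δ : ℝ} {μ : Mesh₅ rc δ} (I : TexInput rc μ)

/-- **CUT special**: both pieces inside the prism of ONE wall cell, the contact across its cut plane. -/
def IsCutSpecial (i i' : Fin I.cells.M) (p : E3 × ℝ) : Prop :=
  ∃ k : Fin rc.nk, polytope (I.cells.Hp i) ⊆ polytope (μ.HP k) ∧ polytope (I.cells.Hp i') ⊆ polytope (μ.HP k) ∧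
    (p = I.cutDatum k ∨ p = antip (I.cutDatum k))

open scoped Classical in
/-- the total weight of the CUT specials (both halves of the ledger) -/
def cutSpecialSum : ℝ :=
  ∑ i, ∑ i' ∈ Finset.univ.filter (fun i' => I.cells.cls i' ≠ I.cells.cls i),
    ∑ p ∈ (I.cells.Hp i).filter (fun p => I.IsCutSpecial i i' p),
      lawW I.frameOf (I.cells.cls i) (I.cells.cls i') p.1 * facetArea (I.contact i i' p) p.1

/-- The cut datum is not its own antipode. -/
theorem cutDatum_ne_antip (k : Fin rc.nk) : I.cutDatum k ≠ antip (I.cutDatum k) := by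
  intro h
  have h1 : (I.cutDatum k).1 = -(I.cutDatum k).1 := congrArg Prod.fst h
  have hn := I.norm_cutDatum k
  have h0 : (I.cutDatum k).1 = 0 := by
    have h2 : (2 : ℝ) • (I.cutDatum k).1 = 0 := by
      rw [two_smul]
      nth_rewrite 2 [h1]
      exact add_neg_cancel _
    exact (smul_eq_zero.1 h2).resolve_left two_ne_zero
  rw [h0, norm_zero] at hn
  exact zero_ne_one hn

/-- The table entries are nonnegative. -/
theorem cell_c_nonneg (k : Fin rc.nk) (a b : ℤ) : 0 ≤ (rc.cell k).c a b := (rc.cell k).hadm.1 a b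

open scoped Classical in
/-- **One pair, one cell**: the cut-special terms of `(i, i')` in cell `k` are at most the (below-`i`, above-`i'`) bound plus the
(below-`i'`, above-`i`) bound. -/
theorem sum_filter_cut_le (k : Fin rc.nk) {i i' : Fin I.cells.M} (hne : i ≠ i') :
    ∑ p ∈ (I.cells.Hp i).filter (fun p => polytope (I.cells.Hp i) ⊆ polytope (μ.HP k) ∧ polytope (I.cells.Hp i') ⊆ polytope (μ.HP k) ∧
        (p = I.cutDatum k ∨ p = antip (I.cutDatum k))),
      lawW I.frameOf (I.cells.cls i) (I.cells.cls i') p.1 * facetArea (I.contact i i' p) p.1 ≤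
    (if (polytope (I.cells.Hp i) ⊆ polytope (μ.HP k) ∧ I.cutDatum k ∈ I.cells.Hp i) ∧
          (polytope (I.cells.Hp i') ⊆ polytope (μ.HP k) ∧ antip (I.cutDatum k) ∈ I.cells.Hp i') then
        (rc.cell k).c (I.slab i) (I.slab i') / 2 * facetArea (I.contact i i' (I.cutDatum k)) (I.cutDatum k).1 else 0) +
    (if (polytope (I.cells.Hp i') ⊆ polytope (μ.HP k) ∧ I.cutDatum k ∈ I.cells.Hp i') ∧
          (polytope (I.cells.Hp i) ⊆ polytope (μ.HP k) ∧ antip (I.cutDatum k) ∈ I.cells.Hp i) then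
        (rc.cell k).c (I.slab i') (I.slab i) / 2 * facetArea (I.contact i' i (I.cutDatum k)) (I.cutDatum k).1 else 0) := by
  have hg0 : ∀ p : E3 × ℝ, 0 ≤ lawW I.frameOf (I.cells.cls i) (I.cells.cls i') p.1 * facetArea (I.contact i i' p) p.1 :=
    fun p => mul_nonneg (lawW_nonneg _ _ _ _) (facetArea_nonneg _ _)
  have hT₁ : 0 ≤ (rc.cell k).c (I.slab i) (I.slab i') / 2 * facetArea (I.contact i i' (I.cutDatum k)) (I.cutDatum k).1 :=
    mul_nonneg (div_nonneg (cell_c_nonneg (rc := rc) k _ _) two_pos.le) (facetArea_nonneg _ _)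
  have hT₂ : 0 ≤ (rc.cell k).c (I.slab i') (I.slab i) / 2 * facetArea (I.contact i' i (I.cutDatum k)) (I.cutDatum k).1 :=
    mul_nonneg (div_nonneg (cell_c_nonneg (rc := rc) k _ _) two_pos.le) (facetArea_nonneg _ _)
  by_cases hP : polytope (I.cells.Hp i) ⊆ polytope (μ.HP k) ∧ polytope (I.cells.Hp i') ⊆ polytope (μ.HP k)
  · obtain ⟨hi, hi'⟩ := hP
    have hsub : (I.cells.Hp i).filter (fun p => polytope (I.cells.Hp i) ⊆ polytope (μ.HP k) ∧ polytope (I.cells.Hp i') ⊆ polytope (μ.HP k) ∧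
        (p = I.cutDatum k ∨ p = antip (I.cutDatum k))) ⊆ ({I.cutDatum k, antip (I.cutDatum k)} : Finset (E3 × ℝ)).filter (fun p => p ∈ I.cells.Hp i) := by
      intro p hp
      obtain ⟨hpH, -, -, hpe⟩ := Finset.mem_filter.1 hp
      refine Finset.mem_filter.2 ⟨?_, hpH⟩
      rcases hpe with rfl | rfl
      · exact Finset.mem_insert_self _ _
      · exact Finset.mem_insert_of_mem (Finset.mem_singleton_self _)
    refine (Finset.sum_le_sum_of_subset_of_nonneg hsub (fun p _ _ => hg0 p)).trans ?_
    rw [Finset.sum_filter, Finset.sum_pair (I.cutDatum_ne_antip k)]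
    refine add_le_add ?_ ?_
    · by_cases hc : I.cutDatum k ∈ I.cells.Hp i
      · rw [if_pos hc]
        refine (I.cut_term_le k hne hi hi' hc).trans (le_of_eq ?_)
        by_cases ha : antip (I.cutDatum k) ∈ I.cells.Hp i'
        · rw [if_pos ha, if_pos ⟨⟨hi, hc⟩, hi', ha⟩]
        · rw [if_neg ha, if_neg (fun h => ha h.2.2)]
      · rw [if_neg hc]; exact ite_nonneg_of hT₁
    · by_cases hac : antip (I.cutDatum k) ∈ I.cells.Hp i
      · rw [if_pos hac]
        refine (I.cut_term_le' k hne hi hi' hac).trans (le_of_eq ?_)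
        by_cases hb : I.cutDatum k ∈ I.cells.Hp i'
        · rw [if_pos hb, if_pos ⟨⟨hi', hb⟩, hi, hac⟩]
        · rw [if_neg hb, if_neg (fun h => hb h.1.2)]
      · rw [if_neg hac]; exact ite_nonneg_of hT₂
  · have hempty : (I.cells.Hp i).filter (fun p => polytope (I.cells.Hp i) ⊆ polytope (μ.HP k) ∧ polytope (I.cells.Hp i') ⊆ polytope (μ.HP k) ∧
        (p = I.cutDatum k ∨ p = antip (I.cutDatum k))) = ∅ :=
      Finset.filter_eq_empty_iff.2 fun p _ h => hP ⟨h.1, h.2.1⟩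
    rw [hempty, Finset.sum_empty]
    exact add_nonneg (ite_nonneg_of hT₁) (ite_nonneg_of hT₂)

open scoped Classical in
/-- **The (below, above) half of one cell**: summing the bounds over all pairs and grouping by slab pair gives `Σ_{(a,b)} c(a,b)/2 · area(cut region)`. -/
theorem sum_sum_ite_cut_le (k : Fin rc.nk) :
    ∑ i : Fin I.cells.M, ∑ i' : Fin I.cells.M,
      (if (polytope (I.cells.Hp i) ⊆ polytope (μ.HP k) ∧ I.cutDatum k ∈ I.cells.Hp i) ∧
            (polytope (I.cells.Hp i') ⊆ polytope (μ.HP k) ∧ antip (I.cutDatum k) ∈ I.cells.Hp i') then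
          (rc.cell k).c (I.slab i) (I.slab i') / 2 * facetArea (I.contact i i' (I.cutDatum k)) (I.cutDatum k).1 else 0) ≤
    ∑ ab ∈ I.slabWindow (μ.fk k) ×ˢ I.slabWindow (μ.gk k), (rc.cell k).c ab.1 ab.2 / 2 *
      facetArea (closure (polytope (μ.HP k)) ∩ closure (laySlab (rc.tent (μ.fk k)).L (rc.tent (μ.fk k)).s ab.1) ∩
        closure (laySlab (rc.tent (μ.gk k)).L (rc.tent (μ.gk k)).s ab.2) ∩ {y : E3 | ⟪(I.cutDatum k).1, y⟫_ℝ = (I.cutDatum k).2}) (I.cutDatum k).1 := by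
  set W := I.slabWindow (μ.fk k) ×ˢ I.slabWindow (μ.gk k) with hW
  have hc0 := cell_c_nonneg (rc := rc) k
  -- the refined indicator terms, by slab pair
  set Φ : ℤ × ℤ → Fin I.cells.M → Fin I.cells.M → ℝ := fun ab i i' =>
    if (polytope (I.cells.Hp i) ⊆ polytope (μ.HP k) ∧ I.cutDatum k ∈ I.cells.Hp i ∧ I.slab i = ab.1) ∧
        (polytope (I.cells.Hp i') ⊆ polytope (μ.HP k) ∧ antip (I.cutDatum k) ∈ I.cells.Hp i' ∧ I.slab i' = ab.2) then
      (rc.cell k).c ab.1 ab.2 / 2 * facetArea (I.contact i i' (I.cutDatum k)) (I.cutDatum k).1 else 0 with hΦ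
  have hΦ0 : ∀ ab i i', 0 ≤ Φ ab i i' := fun ab i i' =>
    ite_nonneg_of (mul_nonneg (div_nonneg (hc0 _ _) two_pos.le) (facetArea_nonneg _ _))
  -- pointwise: each term is one of the `Φ`'s
  have hpt : ∀ i i', (if (polytope (I.cells.Hp i) ⊆ polytope (μ.HP k) ∧ I.cutDatum k ∈ I.cells.Hp i) ∧
        (polytope (I.cells.Hp i') ⊆ polytope (μ.HP k) ∧ antip (I.cutDatum k) ∈ I.cells.Hp i') then
      (rc.cell k).c (I.slab i) (I.slab i') / 2 * facetArea (I.contact i i' (I.cutDatum k)) (I.cutDatum k).1 else 0) ≤ ∑ ab ∈ W, Φ ab i i' := by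
    intro i i'
    split_ifs with h
    · have hgi : I.grain i = μ.fk k := by
        rw [I.grain_eq_of_piece_subset_HP h.1.1, if_pos (I.cutDatum_mem_T_of_mem_Hp h.1.2)]
      have hgi' : I.grain i' = μ.gk k := by
        rw [I.grain_eq_of_piece_subset_HP h.2.1, if_neg (I.cutDatum_not_mem_T_of_antip_mem_Hp h.2.2)]
      have hmem : (I.slab i, I.slab i') ∈ W := by
        refine Finset.mem_product.2 ⟨?_, ?_⟩
        · have := I.slab_mem i; rw [hgi] at this; exact this
        · have := I.slab_mem i'; rw [hgi'] at this; exact this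
      refine le_trans (le_of_eq ?_) (Finset.single_le_sum (fun ab _ => hΦ0 ab i i') hmem)
      simp only [hΦ]
      rw [if_pos (by refine ⟨⟨h.1.1, h.1.2, ?_⟩, ⟨h.2.1, h.2.2, ?_⟩⟩ <;> trivial)]
    · exact Finset.sum_nonneg fun ab _ => hΦ0 ab i i'
  calc ∑ i : Fin I.cells.M, ∑ i' : Fin I.cells.M,
        (if (polytope (I.cells.Hp i) ⊆ polytope (μ.HP k) ∧ I.cutDatum k ∈ I.cells.Hp i) ∧
              (polytope (I.cells.Hp i') ⊆ polytope (μ.HP k) ∧ antip (I.cutDatum k) ∈ I.cells.Hp i') then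
            (rc.cell k).c (I.slab i) (I.slab i') / 2 * facetArea (I.contact i i' (I.cutDatum k)) (I.cutDatum k).1 else 0)
      ≤ ∑ i : Fin I.cells.M, ∑ i' : Fin I.cells.M, ∑ ab ∈ W, Φ ab i i' :=
        Finset.sum_le_sum fun i _ => Finset.sum_le_sum fun i' _ => hpt i i'
    _ = ∑ i : Fin I.cells.M, ∑ ab ∈ W, ∑ i' : Fin I.cells.M, Φ ab i i' := Finset.sum_congr rfl fun i _ => Finset.sum_comm
    _ = ∑ ab ∈ W, ∑ i : Fin I.cells.M, ∑ i' : Fin I.cells.M, Φ ab i i' := Finset.sum_comm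
    _ = ∑ ab ∈ W, (rc.cell k).c ab.1 ab.2 / 2 *
          ∑ i ∈ Finset.univ.filter (fun i => polytope (I.cells.Hp i) ⊆ polytope (μ.HP k) ∧ I.cutDatum k ∈ I.cells.Hp i ∧ I.slab i = ab.1),
            ∑ i' ∈ Finset.univ.filter (fun i' => polytope (I.cells.Hp i') ⊆ polytope (μ.HP k) ∧ antip (I.cutDatum k) ∈ I.cells.Hp i' ∧
              I.slab i' = ab.2), facetArea (I.contact i i' (I.cutDatum k)) (I.cutDatum k).1 := by
        refine Finset.sum_congr rfl fun ab _ => ?_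
        rw [Finset.mul_sum, Finset.sum_filter]
        refine Finset.sum_congr rfl fun i _ => ?_
        by_cases hb : polytope (I.cells.Hp i) ⊆ polytope (μ.HP k) ∧ I.cutDatum k ∈ I.cells.Hp i ∧ I.slab i = ab.1
        · rw [if_pos hb, Finset.mul_sum, Finset.sum_filter]
          refine Finset.sum_congr rfl fun i' _ => ?_
          by_cases ha : polytope (I.cells.Hp i') ⊆ polytope (μ.HP k) ∧ antip (I.cutDatum k) ∈ I.cells.Hp i' ∧ I.slab i' = ab.2
          · simp only [hΦ]; rw [if_pos ⟨hb, ha⟩, if_pos ha]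
          · simp only [hΦ]; rw [if_neg (fun h => ha h.2), if_neg ha]
        · rw [if_neg hb]
          exact Finset.sum_eq_zero fun i' _ => by simp only [hΦ]; rw [if_neg (fun h => hb h.1)]
    _ ≤ _ := Finset.sum_le_sum fun ab _ => mul_le_mul_of_nonneg_left (I.sum_sum_facetArea_cut_le k ab.1 ab.2) (div_nonneg (hc0 _ _) two_pos.le)

open scoped Classical in
/-- **One cell**: the cut-special terms of cell `k`, over all cross-class pairs, are paid by `charge_k + 13/25·ex_k` (given `Good.hcut` for `k`). -/
theorem sum_cut_cell_le (k : Fin rc.nk)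
    (hcutk : ∀ F : Finset (ℤ × ℤ),
      ∑ ij ∈ F, (rc.cell k).c ij.1 ij.2 * facetArea (closure (polytope (μ.HP k)) ∩
        closure (laySlab (rc.tent (μ.fk k)).L (rc.tent (μ.fk k)).s ij.1) ∩ closure (laySlab (rc.tent (μ.gk k)).L (rc.tent (μ.gk k)).s ij.2) ∩
        {y : E3 | ⟪(I.cutDatum k).1, y⟫_ℝ = (I.cutDatum k).2}) (I.cutDatum k).1 ≤ (rc.cell k).charge + 13 / 25 * μ.ex k) :
    ∑ i : Fin I.cells.M, ∑ i' ∈ Finset.univ.filter (fun i' => I.cells.cls i' ≠ I.cells.cls i),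
      ∑ p ∈ (I.cells.Hp i).filter (fun p => polytope (I.cells.Hp i) ⊆ polytope (μ.HP k) ∧ polytope (I.cells.Hp i') ⊆ polytope (μ.HP k) ∧
        (p = I.cutDatum k ∨ p = antip (I.cutDatum k))),
        lawW I.frameOf (I.cells.cls i) (I.cells.cls i') p.1 * facetArea (I.contact i i' p) p.1 ≤ (rc.cell k).charge + 13 / 25 * μ.ex k := by
  have hc0 := cell_c_nonneg (rc := rc) k
  -- the indicator bound of …CutSpecials part 1, as a function
  set Tp : Fin I.cells.M → Fin I.cells.M → ℝ := fun i i' =>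
    if (polytope (I.cells.Hp i) ⊆ polytope (μ.HP k) ∧ I.cutDatum k ∈ I.cells.Hp i) ∧
          (polytope (I.cells.Hp i') ⊆ polytope (μ.HP k) ∧ antip (I.cutDatum k) ∈ I.cells.Hp i') then
      (rc.cell k).c (I.slab i) (I.slab i') / 2 * facetArea (I.contact i i' (I.cutDatum k)) (I.cutDatum k).1 else 0 with hTp
  have hTp0 : ∀ i i', 0 ≤ Tp i i' := fun i i' => ite_nonneg_of (mul_nonneg (div_nonneg (hc0 _ _) two_pos.le) (facetArea_nonneg _ _))
  have hW : ∑ i : Fin I.cells.M, ∑ i' : Fin I.cells.M, Tp i i' ≤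
      ∑ ab ∈ I.slabWindow (μ.fk k) ×ˢ I.slabWindow (μ.gk k), (rc.cell k).c ab.1 ab.2 / 2 *
        facetArea (closure (polytope (μ.HP k)) ∩ closure (laySlab (rc.tent (μ.fk k)).L (rc.tent (μ.fk k)).s ab.1) ∩
          closure (laySlab (rc.tent (μ.gk k)).L (rc.tent (μ.gk k)).s ab.2) ∩ {y : E3 | ⟪(I.cutDatum k).1, y⟫_ℝ = (I.cutDatum k).2})
          (I.cutDatum k).1 := I.sum_sum_ite_cut_le k
  have hsymm : (∑ i : Fin I.cells.M, ∑ i' : Fin I.cells.M, Tp i' i) = ∑ i : Fin I.cells.M, ∑ i' : Fin I.cells.M, Tp i i' :=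
    Finset.sum_comm
  have hpair : ∀ i : Fin I.cells.M, ∀ i' ∈ Finset.univ.filter (fun i' => I.cells.cls i' ≠ I.cells.cls i),
      ∑ p ∈ (I.cells.Hp i).filter (fun p => polytope (I.cells.Hp i) ⊆ polytope (μ.HP k) ∧ polytope (I.cells.Hp i') ⊆ polytope (μ.HP k) ∧
        (p = I.cutDatum k ∨ p = antip (I.cutDatum k))),
        lawW I.frameOf (I.cells.cls i) (I.cells.cls i') p.1 * facetArea (I.contact i i' p) p.1 ≤ Tp i i' + Tp i' i := by
    intro i i' hi'
    exact I.sum_filter_cut_le k (I.ne_of_cls_ne (Finset.mem_filter.1 hi').2)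
  have hdrop : ∀ i : Fin I.cells.M, ∑ i' ∈ Finset.univ.filter (fun i' => I.cells.cls i' ≠ I.cells.cls i), (Tp i i' + Tp i' i) ≤
      ∑ i' : Fin I.cells.M, (Tp i i' + Tp i' i) := fun i =>
    Finset.sum_le_sum_of_subset_of_nonneg (Finset.filter_subset _ _) (fun i' _ _ => add_nonneg (hTp0 i i') (hTp0 i' i))
  have hsplit : ∑ i : Fin I.cells.M, ∑ i' : Fin I.cells.M, (Tp i i' + Tp i' i) =
      (∑ i : Fin I.cells.M, ∑ i' : Fin I.cells.M, Tp i i') + ∑ i : Fin I.cells.M, ∑ i' : Fin I.cells.M, Tp i' i := by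
    rw [← Finset.sum_add_distrib]
    exact Finset.sum_congr rfl fun i _ => Finset.sum_add_distrib
  have hhalf : ∑ ab ∈ I.slabWindow (μ.fk k) ×ˢ I.slabWindow (μ.gk k), (rc.cell k).c ab.1 ab.2 / 2 *
        facetArea (closure (polytope (μ.HP k)) ∩ closure (laySlab (rc.tent (μ.fk k)).L (rc.tent (μ.fk k)).s ab.1) ∩
          closure (laySlab (rc.tent (μ.gk k)).L (rc.tent (μ.gk k)).s ab.2) ∩ {y : E3 | ⟪(I.cutDatum k).1, y⟫_ℝ = (I.cutDatum k).2})
          (I.cutDatum k).1 =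
      (∑ ab ∈ I.slabWindow (μ.fk k) ×ˢ I.slabWindow (μ.gk k), (rc.cell k).c ab.1 ab.2 *
        facetArea (closure (polytope (μ.HP k)) ∩ closure (laySlab (rc.tent (μ.fk k)).L (rc.tent (μ.fk k)).s ab.1) ∩
          closure (laySlab (rc.tent (μ.gk k)).L (rc.tent (μ.gk k)).s ab.2) ∩ {y : E3 | ⟪(I.cutDatum k).1, y⟫_ℝ = (I.cutDatum k).2})
          (I.cutDatum k).1) / 2 := by
    rw [Finset.sum_div]
    exact Finset.sum_congr rfl fun ab _ => by ring
  have hF := hcutk (I.slabWindow (μ.fk k) ×ˢ I.slabWindow (μ.gk k))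
  calc _ ≤ ∑ i : Fin I.cells.M, ∑ i' ∈ Finset.univ.filter (fun i' => I.cells.cls i' ≠ I.cells.cls i), (Tp i i' + Tp i' i) :=
        Finset.sum_le_sum fun i _ => Finset.sum_le_sum fun i' hi' => hpair i i' hi'
    _ ≤ ∑ i : Fin I.cells.M, ∑ i' : Fin I.cells.M, (Tp i i' + Tp i' i) := Finset.sum_le_sum fun i _ => hdrop i
    _ ≤ (rc.cell k).charge + 13 / 25 * μ.ex k := by
        rw [hsplit, hsymm]
        linarith

/-- **(L-C) THE CUT SPECIALS ARE PAID BY THE CHARGES (+ slice excess)**: under the Cavalieri clause of the input's cut levels (`Good.hcut`),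
`cutSpecialSum ≤ chargeSum + 13/25·Σ_k ex k`. -/
theorem cutSpecialSum_le
    (hcut : ∀ (k : Fin rc.nk) (F : Finset (ℤ × ℤ)),
      ∑ ij ∈ F, (rc.cell k).c ij.1 ij.2 * facetArea (closure (polytope (μ.HP k)) ∩
        closure (laySlab (rc.tent (μ.fk k)).L (rc.tent (μ.fk k)).s ij.1) ∩ closure (laySlab (rc.tent (μ.gk k)).L (rc.tent (μ.gk k)).s ij.2) ∩
        {y : E3 | ⟪(I.cutDatum k).1, y⟫_ℝ = (I.cutDatum k).2}) (I.cutDatum k).1 ≤ (rc.cell k).charge + 13 / 25 * μ.ex k) :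
    I.cutSpecialSum ≤ rc.chargeSum + 13 / 25 * ∑ k, μ.ex k := by
  classical
  have hg0 : ∀ (i i' : Fin I.cells.M) (p : E3 × ℝ), 0 ≤ lawW I.frameOf (I.cells.cls i) (I.cells.cls i') p.1 * facetArea (I.contact i i' p) p.1 :=
    fun _ _ p => mul_nonneg (lawW_nonneg _ _ _ _) (facetArea_nonneg _ _)
  -- split the specials by cell and bring the cell sum outside
  have h1 : I.cutSpecialSum ≤ ∑ k : Fin rc.nk, ∑ i : Fin I.cells.M, ∑ i' ∈ Finset.univ.filter (fun i' => I.cells.cls i' ≠ I.cells.cls i),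
      ∑ p ∈ (I.cells.Hp i).filter (fun p => polytope (I.cells.Hp i) ⊆ polytope (μ.HP k) ∧ polytope (I.cells.Hp i') ⊆ polytope (μ.HP k) ∧
        (p = I.cutDatum k ∨ p = antip (I.cutDatum k))),
        lawW I.frameOf (I.cells.cls i) (I.cells.cls i') p.1 * facetArea (I.contact i i' p) p.1 := by
    unfold cutSpecialSum
    calc _ ≤ ∑ i : Fin I.cells.M, ∑ i' ∈ Finset.univ.filter (fun i' => I.cells.cls i' ≠ I.cells.cls i), ∑ k : Fin rc.nk,
          ∑ p ∈ (I.cells.Hp i).filter (fun p => polytope (I.cells.Hp i) ⊆ polytope (μ.HP k) ∧ polytope (I.cells.Hp i') ⊆ polytope (μ.HP k) ∧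
            (p = I.cutDatum k ∨ p = antip (I.cutDatum k))),
            lawW I.frameOf (I.cells.cls i) (I.cells.cls i') p.1 * facetArea (I.contact i i' p) p.1 := by
          refine Finset.sum_le_sum fun i _ => Finset.sum_le_sum fun i' _ => ?_
          exact sum_filter_le_sum_sum_filter (I.cells.Hp i) (fun p => I.IsCutSpecial i i' p)
            (fun k p => polytope (I.cells.Hp i) ⊆ polytope (μ.HP k) ∧ polytope (I.cells.Hp i') ⊆ polytope (μ.HP k) ∧
              (p = I.cutDatum k ∨ p = antip (I.cutDatum k))) (fun p hp => hp) _ (hg0 i i')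
      _ = ∑ i : Fin I.cells.M, ∑ k : Fin rc.nk, ∑ i' ∈ Finset.univ.filter (fun i' => I.cells.cls i' ≠ I.cells.cls i),
          ∑ p ∈ (I.cells.Hp i).filter (fun p => polytope (I.cells.Hp i) ⊆ polytope (μ.HP k) ∧ polytope (I.cells.Hp i') ⊆ polytope (μ.HP k) ∧
            (p = I.cutDatum k ∨ p = antip (I.cutDatum k))),
            lawW I.frameOf (I.cells.cls i) (I.cells.cls i') p.1 * facetArea (I.contact i i' p) p.1 :=
          Finset.sum_congr rfl fun i _ => Finset.sum_comm
      _ = _ := Finset.sum_comm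
  calc I.cutSpecialSum ≤ _ := h1
    _ ≤ ∑ k : Fin rc.nk, ((rc.cell k).charge + 13 / 25 * μ.ex k) := Finset.sum_le_sum fun k _ => I.sum_cut_cell_le k (hcut k)
    _ = rc.chargeSum + 13 / 25 * ∑ k, μ.ex k := by
        rw [Finset.sum_add_distrib, ← Finset.mul_sum]
        simp only [CellCover.chargeSum]

end TexInput

end Summit.Ventures.Crystal3D.Cruxes.TextureLiminf.TexShadow

end
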